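import Mathlib
import Summits.Ventures.PercRepro2.Defs
import Summits.Ventures.PercRepro2.Graph
import Summits.Ventures.PercRepro2.HullDefs
import Summits.Ventures.PercRepro2.LocRows
import Summits.Ventures.PercRepro2.SwRow

/-!
# A vertex of degree two: the deleted and the contracted graph (blind cell PercRepro2, night-4 g5,
2026-08-24; proofs/NIGHT4-BRIDGE.md §4)

A vertex `w` of degree two with edges `e₁ = {w, u}`, `e₂ = {w, v}` (`u ≠ v`).  The DELETED graph
`G − w` lives on the edges `E' = {e ∣ e ≠ e₁ ∧ e ≠ e₂}` (`delEnds`), the CONTRACTED graph `G / w` on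
`E' ⊕ Unit` with the new edge `{u, v}` (`conEnds`); both keep the vertex type (`w` is isolated).
For a configuration `ζ` of `G` with `ζ e₁ = ζ e₂` the red (resp. blue) clusters of `G` are those of
`G / w` with `{u, v}` red (resp. of `G − w`), up to the vertex `w` (`cluster_same_eq`,
`cluster_same_other_eq`); with `ζ e₁ ≠ ζ e₂` they are those of `G − w`, up to `w`
(`cluster_mixed_eq`).  These are the cluster correspondences behind the series reduction of row
2′SW-ALL (next file).
-/

namespace Summit.Ventures.PercRepro2

namespace Series

open Hull LocRows

open scoped Classical

variable {V : Type*} {E : Type*}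

/-- The data of a vertex `w` of degree two: its two edges `e₁ = {w, u}`, `e₂ = {w, v}`. -/
structure IsDeg2 (ends : E → Sym2 V) (w u v : V) (e₁ e₂ : E) : Prop where
  /-- `e₁ = {w, u}`. -/
  ends₁ : ends e₁ = s(w, u)
  /-- `e₂ = {w, v}`. -/
  ends₂ : ends e₂ = s(w, v)
  /-- The two edges are distinct. -/
  ne : e₁ ≠ e₂
  /-- `u ≠ v`. -/
  uv : u ≠ v
  /-- `w ≠ u`. -/
  wu : w ≠ u
  /-- `w ≠ v`. -/
  wv : w ≠ v
  /-- Every edge at `w` is `e₁` or `e₂`. -/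
  deg : ∀ e, w ∈ ends e → e = e₁ ∨ e = e₂

variable {ends : E → Sym2 V} {w u v : V} {e₁ e₂ : E}

/-- The edges of `G − w`. -/
abbrev DelE (e₁ e₂ : E) : Type _ := {e : E // e ≠ e₁ ∧ e ≠ e₂}

/-- The incidence map of `G − w`. -/
def delEnds (ends : E → Sym2 V) (e₁ e₂ : E) : DelE e₁ e₂ → Sym2 V := fun e => ends e.1

/-- The incidence map of `G / w`: the old edges and the new edge `{u, v}`. -/
def conEnds (ends : E → Sym2 V) (u v : V) (e₁ e₂ : E) : DelE e₁ e₂ ⊕ Unit → Sym2 V :=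
  Sum.elim (delEnds ends e₁ e₂) (fun _ => s(u, v))

/-- The restriction of a configuration to `G − w`. -/
def delConfig (ζ : Config E) : Config (DelE e₁ e₂) := fun e => ζ e.1

/-- The configuration of `G / w` with the new edge of colour `c`. -/
def conConfig (ζ : Config E) (c : Bool) : Config (DelE e₁ e₂ ⊕ Unit) :=
  Sum.elim (delConfig (e₁ := e₁) (e₂ := e₂) ζ) (fun _ => c)

/-- The restriction commutes with the colour swap. -/
lemma delConfig_blue (ζ : Config E) :
    delConfig (e₁ := e₁) (e₂ := e₂) (blue ζ) = blue (delConfig ζ) := rfl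

/-- The contracted configuration commutes with the colour swap. -/
lemma conConfig_blue (ζ : Config E) (c : Bool) :
    conConfig (e₁ := e₁) (e₂ := e₂) (blue ζ) (!c) = blue (conConfig ζ c) := by
  funext e; rcases e with e | e <;> rfl

/-- An edge of `G` other than `e₁`, `e₂` does not touch `w`. -/
lemma not_mem_ends_of_ne (hd : IsDeg2 ends w u v e₁ e₂) {e : E} (h₁ : e ≠ e₁) (h₂ : e ≠ e₂) :
    w ∉ ends e := fun hw => (hd.deg e hw).elim h₁ h₂

/-- An open adjacency of `G` is an adjacency of `G − w`, or uses `e₁` or `e₂`. -/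
lemma adj_cases (hd : IsDeg2 ends w u v e₁ e₂) {ζ : Config E} {x y : V}
    (hxy : (openGraph ends ζ).Adj x y) :
    (openGraph (delEnds ends e₁ e₂) (delConfig ζ)).Adj x y ∨
      (ζ e₁ = true ∧ s(x, y) = s(w, u)) ∨ (ζ e₂ = true ∧ s(x, y) = s(w, v)) := by
  obtain ⟨hne, e, he, hends⟩ := openGraph_adj.1 hxy
  by_cases h₁ : e = e₁
  · subst h₁; exact Or.inr (Or.inl ⟨he, by rw [← hends, hd.ends₁]⟩)
  by_cases h₂ : e = e₂
  · subst h₂; exact Or.inr (Or.inr ⟨he, by rw [← hends, hd.ends₂]⟩)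
  · exact Or.inl (openGraph_adj.2 ⟨hne, ⟨e, h₁, h₂⟩, he, hends⟩)

/-- An adjacency of `G − w` is an adjacency of `G`. -/
lemma adj_of_del {ζ : Config E} {x y : V}
    (hxy : (openGraph (delEnds ends e₁ e₂) (delConfig ζ)).Adj x y) : (openGraph ends ζ).Adj x y := by
  obtain ⟨hne, e, he, hends⟩ := openGraph_adj.1 hxy
  exact openGraph_adj.2 ⟨hne, e.1, he, hends⟩

/-- A vertex of `G − w` adjacent to something is not `w`. -/
lemma ne_w_of_adj_del (hd : IsDeg2 ends w u v e₁ e₂) {ζ : Config E} {x y : V}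
    (hxy : (openGraph (delEnds ends e₁ e₂) (delConfig ζ)).Adj x y) : x ≠ w := by
  obtain ⟨_, e, _, hends⟩ := openGraph_adj.1 hxy
  intro hx
  apply not_mem_ends_of_ne hd e.2.1 e.2.2
  rw [show ends e.1 = s(x, y) from hends, hx]; exact Sym2.mem_mk_left w y

/-- Clusters of `G − w` avoid `w` (for `x ≠ w`). -/
lemma cluster_del_subset (hd : IsDeg2 ends w u v e₁ e₂) {ζ : Config E} {x : V} (hx : x ≠ w) :
    cluster (delEnds ends e₁ e₂) (delConfig ζ) x ⊆ {y | y ≠ w} := by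
  intro y hy
  refine mem_of_conn_of_closed (ends := delEnds ends e₁ e₂) (ω := delConfig ζ) ?_ hx hy
  intro a _ b hab
  exact ne_w_of_adj_del hd hab.symm

/-! ## The mixed case: `ζ e₁ ≠ ζ e₂` -/

/-- In the mixed case, for `x ≠ w`, the red cluster of `x` in `G` is its cluster in `G − w`, plus `w`
when the red one of `e₁`, `e₂` leads into that cluster. -/
theorem cluster_mixed_eq (hd : IsDeg2 ends w u v e₁ e₂) {ζ : Config E}
    (hmix : ζ e₁ ≠ ζ e₂) {x : V} (hx : x ≠ w) :
    cluster ends ζ x = cluster (delEnds ends e₁ e₂) (delConfig ζ) x ∪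
      {y | y = w ∧ ((ζ e₁ = true ∧ u ∈ cluster (delEnds ends e₁ e₂) (delConfig ζ) x) ∨
        (ζ e₂ = true ∧ v ∈ cluster (delEnds ends e₁ e₂) (delConfig ζ) x))} := by
  apply Set.Subset.antisymm
  · intro y hy
    refine mem_of_conn_of_closed (ends := ends) (ω := ζ) ?_ (Or.inl (mem_cluster_self _ _ _)) hy
    rintro a ha b hab
    rcases adj_cases hd hab with h | ⟨he, hs⟩ | ⟨he, hs⟩
    · -- an edge of `G − w`: `a ≠ w`, so `a` is in the deleted cluster
      have ha' : a ∈ cluster (delEnds ends e₁ e₂) (delConfig ζ) x := by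
        rcases ha with ha | ⟨haw, _⟩
        · exact ha
        · exact absurd haw (ne_w_of_adj_del hd h)
      exact Or.inl (mem_cluster_of_adj ha' h)
    · -- the edge `e₁` (red): `{a, b} = {w, u}`
      rcases Sym2.eq_iff.1 hs with ⟨haw, hbu⟩ | ⟨hau, hbw⟩
      · -- `a = w`: `w` entered through `e₁` (as `e₂` is blue), so `u` is in the deleted cluster
        subst haw; subst hbu
        rcases ha with ha | ⟨_, ⟨_, hu⟩ | ⟨he₂, _⟩⟩
        · exact absurd rfl (cluster_del_subset hd hx ha)
        · exact Or.inl hu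
        · exact absurd (he.trans he₂.symm) hmix
      · subst hau; subst hbw
        rcases ha with ha | ⟨haw, _⟩
        · exact Or.inr ⟨rfl, Or.inl ⟨he, ha⟩⟩
        · exact absurd haw.symm hd.wu
    · -- the edge `e₂` (red): `{a, b} = {w, v}`
      rcases Sym2.eq_iff.1 hs with ⟨haw, hbv⟩ | ⟨hav, hbw⟩
      · subst haw; subst hbv
        rcases ha with ha | ⟨_, ⟨he₁, _⟩ | ⟨_, hv⟩⟩
        · exact absurd rfl (cluster_del_subset hd hx ha)
        · exact absurd (he₁.trans he.symm) hmix
        · exact Or.inl hv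
      · subst hav; subst hbw
        rcases ha with ha | ⟨haw, _⟩
        · exact Or.inr ⟨rfl, Or.inr ⟨he, ha⟩⟩
        · exact absurd haw.symm hd.wv
  · rintro y (hy | ⟨rfl, ⟨he, hu⟩ | ⟨he, hv⟩⟩)
    · -- the deleted cluster sits inside the cluster of `G`
      refine mem_of_conn_of_closed (ends := delEnds ends e₁ e₂) (ω := delConfig ζ) ?_
        (mem_cluster_self _ _ _) hy
      intro a ha b hab
      exact mem_cluster_of_adj ha (adj_of_del hab)
    · have hu' : u ∈ cluster ends ζ x := by
        refine mem_of_conn_of_closed (ends := delEnds ends e₁ e₂) (ω := delConfig ζ) ?_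
          (mem_cluster_self _ _ _) hu
        intro a ha b hab
        exact mem_cluster_of_adj ha (adj_of_del hab)
      exact mem_cluster_of_edge (ends := ends) hu' (e := e₁) he (by rw [hd.ends₁, Sym2.eq_swap])
    · have hv' : v ∈ cluster ends ζ x := by
        refine mem_of_conn_of_closed (ends := delEnds ends e₁ e₂) (ω := delConfig ζ) ?_
          (mem_cluster_self _ _ _) hv
        intro a ha b hab
        exact mem_cluster_of_adj ha (adj_of_del hab)
      exact mem_cluster_of_edge (ends := ends) hv' (e := e₂) he (by rw [hd.ends₂, Sym2.eq_swap])

/-! ## The same-colour case: `ζ e₁ = ζ e₂` -/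

/-- An open adjacency of `G / w` is an adjacency of `G − w` or the new edge (when red). -/
lemma adj_con_cases {ζ : Config E} {c : Bool} {x y : V}
    (hxy : (openGraph (conEnds ends u v e₁ e₂) (conConfig (e₁ := e₁) (e₂ := e₂) ζ c)).Adj x y) :
    (openGraph (delEnds ends e₁ e₂) (delConfig ζ)).Adj x y ∨ (c = true ∧ s(x, y) = s(u, v)) := by
  obtain ⟨hne, e, he, hends⟩ := openGraph_adj.1 hxy
  rcases e with e | e
  · exact Or.inl (openGraph_adj.2 ⟨hne, e, he, hends⟩)
  · exact Or.inr ⟨he, by rw [← hends]; rfl⟩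

/-- An adjacency of `G − w` is an adjacency of `G / w`. -/
lemma adj_con_of_del {ζ : Config E} {c : Bool} {x y : V}
    (hxy : (openGraph (delEnds ends e₁ e₂) (delConfig ζ)).Adj x y) :
    (openGraph (conEnds ends u v e₁ e₂) (conConfig (e₁ := e₁) (e₂ := e₂) ζ c)).Adj x y := by
  obtain ⟨hne, e, he, hends⟩ := openGraph_adj.1 hxy
  exact openGraph_adj.2 ⟨hne, Sum.inl e, he, hends⟩

/-- The new edge of `G / w` is an open adjacency when red. -/
lemma adj_con_uv (hd : IsDeg2 ends w u v e₁ e₂) (ζ : Config E) :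
    (openGraph (conEnds ends u v e₁ e₂) (conConfig (e₁ := e₁) (e₂ := e₂) ζ true)).Adj u v :=
  openGraph_adj.2 ⟨hd.uv, Sum.inr (), rfl, rfl⟩

/-- Clusters of `G / w` avoid `w` (for `x ≠ w`). -/
lemma cluster_con_subset (hd : IsDeg2 ends w u v e₁ e₂) {ζ : Config E} {c : Bool} {x : V}
    (hx : x ≠ w) :
    cluster (conEnds ends u v e₁ e₂) (conConfig (e₁ := e₁) (e₂ := e₂) ζ c) x ⊆ {y | y ≠ w} := by
  intro y hy
  refine mem_of_conn_of_closed (ends := conEnds ends u v e₁ e₂) (ω := conConfig ζ c) ?_ hx hy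
  intro a ha b hab
  rcases adj_con_cases hab with h | ⟨_, hs⟩
  · exact ne_w_of_adj_del hd h.symm
  · rcases Sym2.eq_iff.1 hs with ⟨_, hb⟩ | ⟨_, hb⟩
    · rw [hb]; exact hd.wv.symm
    · rw [hb]; exact hd.wu.symm

/-- In the both-red case, for `x ≠ w`, the red cluster of `x` in `G` is its cluster in `G / w` with
the new edge red, plus `w` when that cluster contains `u`. -/
theorem cluster_same_eq (hd : IsDeg2 ends w u v e₁ e₂) {ζ : Config E} (h₁ : ζ e₁ = true)
    (h₂ : ζ e₂ = true) {x : V} (hx : x ≠ w) :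
    cluster ends ζ x = cluster (conEnds ends u v e₁ e₂) (conConfig (e₁ := e₁) (e₂ := e₂) ζ true) x ∪
      {y | y = w ∧ u ∈ cluster (conEnds ends u v e₁ e₂) (conConfig (e₁ := e₁) (e₂ := e₂) ζ true) x} := by
  apply Set.Subset.antisymm
  · intro y hy
    refine mem_of_conn_of_closed (ends := ends) (ω := ζ) ?_ (Or.inl (mem_cluster_self _ _ _)) hy
    rintro a ha b hab
    rcases adj_cases hd hab with h | ⟨_, hs⟩ | ⟨_, hs⟩
    · have ha' : a ∈ cluster (conEnds ends u v e₁ e₂) (conConfig ζ true) x := by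
        rcases ha with ha | ⟨haw, _⟩
        · exact ha
        · exact absurd haw (ne_w_of_adj_del hd h)
      exact Or.inl (mem_cluster_of_adj ha' (adj_con_of_del h))
    · rcases Sym2.eq_iff.1 hs with ⟨haw, hbu⟩ | ⟨hau, hbw⟩
      · subst haw; subst hbu
        rcases ha with ha | ⟨_, hu⟩
        · exact absurd rfl (cluster_con_subset hd hx ha)
        · exact Or.inl hu
      · subst hau; subst hbw
        rcases ha with ha | ⟨haw, _⟩
        · exact Or.inr ⟨rfl, ha⟩
        · exact absurd haw.symm hd.wu
    · rcases Sym2.eq_iff.1 hs with ⟨haw, hbv⟩ | ⟨hav, hbw⟩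
      · subst haw; subst hbv
        rcases ha with ha | ⟨_, hu⟩
        · exact absurd rfl (cluster_con_subset hd hx ha)
        · exact Or.inl (mem_cluster_of_adj hu (adj_con_uv hd ζ))
      · subst hav; subst hbw
        rcases ha with ha | ⟨haw, _⟩
        · exact Or.inr ⟨rfl, mem_cluster_of_adj ha (adj_con_uv hd ζ).symm⟩
        · exact absurd haw.symm hd.wv
  · -- the contracted cluster sits inside the cluster of `G`
    have hsub : cluster (conEnds ends u v e₁ e₂) (conConfig (e₁ := e₁) (e₂ := e₂) ζ true) x ⊆
        cluster ends ζ x := by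
      intro y hy
      refine mem_of_conn_of_closed (ends := conEnds ends u v e₁ e₂) (ω := conConfig ζ true) ?_
        (mem_cluster_self _ _ _) hy
      intro a ha b hab
      rcases adj_con_cases hab with h | ⟨_, hs⟩
      · exact mem_cluster_of_adj ha (adj_of_del h)
      · rcases Sym2.eq_iff.1 hs with ⟨hau, hbv⟩ | ⟨hav, hbu⟩
        · subst hau; subst hbv
          have hw : w ∈ cluster ends ζ x :=
            mem_cluster_of_edge (ends := ends) ha (e := e₁) h₁ (by rw [hd.ends₁, Sym2.eq_swap])
          exact mem_cluster_of_edge (ends := ends) hw (e := e₂) h₂ hd.ends₂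
        · subst hav; subst hbu
          have hw : w ∈ cluster ends ζ x :=
            mem_cluster_of_edge (ends := ends) ha (e := e₂) h₂ (by rw [hd.ends₂, Sym2.eq_swap])
          exact mem_cluster_of_edge (ends := ends) hw (e := e₁) h₁ hd.ends₁
    rintro y (hy | ⟨rfl, hu⟩)
    · exact hsub hy
    · exact mem_cluster_of_edge (ends := ends) (hsub hu) (e := e₁) h₁ (by rw [hd.ends₁, Sym2.eq_swap])

/-- In the both-blue case, the red cluster of any `x` in `G` is its cluster in `G − w`. -/
theorem cluster_same_other_eq (hd : IsDeg2 ends w u v e₁ e₂) {ζ : Config E} (h₁ : ζ e₁ = false)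
    (h₂ : ζ e₂ = false) {x : V} :
    cluster ends ζ x = cluster (delEnds ends e₁ e₂) (delConfig ζ) x := by
  apply Set.Subset.antisymm
  · intro y hy
    refine mem_of_conn_of_closed (ends := ends) (ω := ζ) ?_ (mem_cluster_self _ _ _) hy
    intro a ha b hab
    rcases adj_cases hd hab with h | ⟨he, _⟩ | ⟨he, _⟩
    · exact mem_cluster_of_adj ha h
    · rw [h₁] at he; exact absurd he Bool.false_ne_true
    · rw [h₂] at he; exact absurd he Bool.false_ne_true
  · intro y hy
    refine mem_of_conn_of_closed (ends := delEnds ends e₁ e₂) (ω := delConfig ζ) ?_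
      (mem_cluster_self _ _ _) hy
    intro a ha b hab
    exact mem_cluster_of_adj ha (adj_of_del hab)


end Series

end Summit.Ventures.PercRepro2
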